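import Summits.Ventures.PercRepro.C041ZoneZPerZoneDefs

/-!
# The per-zone dictionary (p6, gen 27; C-041.md §11–§12 — part 2)

Setting of `C041ZoneZPerZoneDefs`: an indexed zone `Z` of `O`, `F = zoneFZ a b O Z`, a zone-state `x`, its extension
`S = extZone a b O Z x` and its abstract state `σ = toStZ x`.  The abstract notions read on `σ` are the tree's notions
read on `S` restricted to `Z`: blue / red adjacency from a vertex of `Z` = `BlueBareAdj S` / `RedIn S Z`
(`zone_blueAdj_iff`, `zone_redAdj_iff`); marks = terminal edges at the vertices of `Z`; the reaches from vertices of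
`Z` = `BlueBareConn S` / red bare walks inside `Z`; `D` = attached to `a` (`zone_mem_D_iff`), `adm` = «no sub-zone
of `Z` attached to both» (`zone_adm_iff`), `Γ` for the protected anchor `{c} ∩ Z` = «the sub-zone of the probe, when
`c ∈ Z`, is unattached» (`zone_gam_iff`), `Forced` = «the red `O`-chords are red» (`zone_forced_iff`); hence
**`AdmZone ⟺ Forced ∧ adm ∧ Γ`** (`zone_admZone_iff`; the cube condition on the opened edges is automatic in an
indexed zone, `interiorBlue_of_idxZone`).  The blue-below-`O` hypothesis of the blue walks is `blueSub_extZone_of_chords`.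
-/

namespace PercRepro

namespace MultiGraph

open Finset ZoneZ ZoneZ.ZoneData

variable {V E : Type*} {G : MultiGraph V E} {a b c : V}

section Zone

variable [Fintype V] (hc : c ≠ a ∧ c ≠ b) (O : Config E) {Z : Finset V} (hZ : G.IsIdxZone a b c O Z)
  (x : G.ZoneState a b Z)

/-- The protected anchors of the zone: `{c}` when `c ∈ Z`, empty otherwise. -/
def zoneQ (c : V) (Z : Finset V) : Set V := {v | v = c ∧ c ∈ Z}

/-- The anchors of the zone: its vertices in `K₀`. -/
def zoneA (a b c : V) (O : Config E) (Z : Finset V) : Set V := {w | w ∈ Z ∧ w ∈ G.BareReach a b c O}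

include hc hZ

omit hc in
/-- A blue bare walk of a configuration blue-below `O` from a vertex of the indexed zone stays in it. -/
theorem mem_of_blueBareConn_idx {S : Config E} (hsub : G.BlueSub a b O S) {u v : V} (hu : u ∈ Z)
    (h : G.BlueBareConn a b S u v) : v ∈ Z := by
  obtain ⟨z, hz⟩ := hZ.1
  subst hz
  exact mem_zone_of_blueBareConn hsub hu h

omit hc hZ in
/-- A blue bare `O`-edge from a vertex of a zone ends in the zone. -/
theorem mem_of_blueBareAdj_O {z u v : V} (hu : u ∈ G.zone a b O z) (h : G.BlueBareAdj a b O u v) :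
    v ∈ G.zone a b O z :=
  mem_zone_of_blueBareConn_O hu (BlueBareConn.single h)

omit hc in
/-- Blue adjacency from a vertex of `Z` is blue bare adjacency of the extension. -/
theorem zone_blueAdj_iff (hsub : G.BlueSub a b O (G.extZone a b O Z x)) {u v : V} (hu : u ∈ Z) :
    (G.zoneFZ a b O Z).BlueAdj (G.toStZ a b Z x) u v ↔ G.BlueBareAdj a b (G.extZone a b O Z x) u v := by
  constructor
  · rintro ⟨e, hj, hc⟩
    rw [toStZ_fst O Z x e] at hc
    exact ⟨e.1, e.2.1, hc, hj⟩
  · rintro ⟨e, he, hSe, hj⟩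
    have hv : v ∈ Z := mem_of_blueBareConn_idx O hZ hsub hu (BlueBareConn.single ⟨e, he, hSe, hj⟩)
    have hends : G.fst e ∈ Z ∧ G.snd e ∈ Z := by
      rcases hj with ⟨h1, h2⟩ | ⟨h1, h2⟩
      · exact ⟨h1 ▸ hu, h2 ▸ hv⟩
      · exact ⟨h1 ▸ hv, h2 ▸ hu⟩
    refine ⟨⟨e, he, hends⟩, hj, ?_⟩
    rw [toStZ_fst O Z x]
    exact hSe

omit [Fintype V] hc hZ in
/-- Red adjacency is red bare adjacency inside `Z` of the extension. -/
theorem zone_redAdj_iff {u v : V} :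
    (G.zoneFZ a b O Z).RedAdj (G.toStZ a b Z x) u v ↔ G.RedIn a b (G.extZone a b O Z x) Z u v := by
  constructor
  · rintro ⟨e, hj, hc⟩
    rw [toStZ_fst O Z x e] at hc
    exact ⟨e.1, zoneEdge_of_zBare e.2, e.2.1, hc, hj⟩
  · rintro ⟨e, hZe, he, hSe, hj⟩
    refine ⟨⟨e, zBare_of_zoneEdge hZe (not_zT1_of_bare he) (not_zT2_of_bare he)⟩, hj, ?_⟩
    rw [toStZ_fst O Z x]
    exact hSe

/-- The marks of side `a`: an `a`-edge of colour `y` at a vertex of `Z`. -/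
theorem zone_mem_mark1_iff (y : Bool) (v : V) :
    v ∈ markSet (G.zoneFZ a b O Z).at₁ (G.toStZ a b Z x).2.1 y ↔
      v ∈ Z ∧ ∃ e, G.Joins e v a ∧ G.extZone a b O Z x e = y := by
  constructor
  · rintro ⟨⟨e, w, hw, hj⟩, ht, hm⟩
    have hw' := ne_terminal_of_mem_idxZone hc hZ hw
    change G.nonTermEnd a b e = v at ht
    rw [nonTermEnd_eq hw' (Or.inl rfl) hj] at ht
    subst ht
    rw [toStZ_snd_fst O Z x] at hm
    exact ⟨hw, e, hj, hm⟩
  · rintro ⟨hv, e, hj, hm⟩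
    refine ⟨⟨e, v, hv, hj⟩, nonTermEnd_eq (ne_terminal_of_mem_idxZone hc hZ hv) (Or.inl rfl) hj, ?_⟩
    rw [toStZ_snd_fst O Z x]
    exact hm

/-- The marks of side `b`: a `b`-edge of colour `y` at a vertex of `Z`. -/
theorem zone_mem_mark2_iff (y : Bool) (v : V) :
    v ∈ markSet (G.zoneFZ a b O Z).at₂ (G.toStZ a b Z x).2.2 y ↔
      v ∈ Z ∧ ∃ e, G.Joins e v b ∧ G.extZone a b O Z x e = y := by
  constructor
  · rintro ⟨⟨e, w, hw, hj⟩, ht, hm⟩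
    have hw' := ne_terminal_of_mem_idxZone hc hZ hw
    change G.nonTermEnd a b e = v at ht
    rw [nonTermEnd_eq hw' (Or.inr rfl) hj] at ht
    subst ht
    rw [toStZ_snd_snd O Z x] at hm
    exact ⟨hw, e, hj, hm⟩
  · rintro ⟨hv, e, hj, hm⟩
    refine ⟨⟨e, v, hv, hj⟩, nonTermEnd_eq (ne_terminal_of_mem_idxZone hc hZ hv) (Or.inr rfl) hj, ?_⟩
    rw [toStZ_snd_snd O Z x]
    exact hm

/-- A blocker: a blue `a`-edge at a vertex of `Z`. -/
theorem zone_mem_Bl_iff (v : V) :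
    v ∈ (G.zoneFZ a b O Z).Bl (G.toStZ a b Z x) ↔ v ∈ Z ∧ ∃ e, G.Joins e v a ∧ G.extZone a b O Z x e = false :=
  zone_mem_mark1_iff hc O hZ x false v

/-- A red `1`-mark: a red `a`-edge at a vertex of `Z`. -/
theorem zone_mem_Blt_iff (v : V) :
    v ∈ (G.zoneFZ a b O Z).Blt (G.toStZ a b Z x) ↔ v ∈ Z ∧ ∃ e, G.Joins e v a ∧ G.extZone a b O Z x e = true :=
  zone_mem_mark1_iff hc O hZ x true v

/-- A blue `2`-mark: a blue `b`-edge at a vertex of `Z`. -/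
theorem zone_mem_M_iff (v : V) :
    v ∈ (G.zoneFZ a b O Z).M (G.toStZ a b Z x) ↔ v ∈ Z ∧ ∃ e, G.Joins e v b ∧ G.extZone a b O Z x e = false :=
  zone_mem_mark2_iff hc O hZ x false v

/-- A red `2`-mark: a red `b`-edge at a vertex of `Z`. -/
theorem zone_mem_Mt_iff (v : V) :
    v ∈ (G.zoneFZ a b O Z).Mt (G.toStZ a b Z x) ↔ v ∈ Z ∧ ∃ e, G.Joins e v b ∧ G.extZone a b O Z x e = true :=
  zone_mem_mark2_iff hc O hZ x true v

omit hc in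
/-- The blue reach of a set of vertices of `Z` is blue bare connectivity of the extension. -/
theorem zone_mem_reach_blue_iff (hsub : G.BlueSub a b O (G.extZone a b O Z x)) {S' : Set V}
    (hS' : ∀ s ∈ S', s ∈ Z) (v : V) :
    v ∈ reach ((G.zoneFZ a b O Z).BlueAdj (G.toStZ a b Z x)) S' ↔
      ∃ s ∈ S', G.BlueBareConn a b (G.extZone a b O Z x) s v := by
  constructor
  · rintro ⟨s, hs, h⟩
    refine ⟨s, hs, ?_⟩
    induction h with
    | refl => exact BlueBareConn.refl a b _ s
    | tail _ hxy ih =>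
      exact ih.tail ((zone_blueAdj_iff O hZ x hsub (mem_of_blueBareConn_idx O hZ hsub (hS' s hs) ih)).1 hxy)
  · rintro ⟨s, hs, h⟩
    refine ⟨s, hs, ?_⟩
    induction h with
    | refl => exact Relation.ReflTransGen.refl
    | tail hpre hxy ih =>
      exact ih.tail ((zone_blueAdj_iff O hZ x hsub (mem_of_blueBareConn_idx O hZ hsub (hS' s hs) hpre)).2 hxy)

omit [Fintype V] hc hZ in
/-- The red reach of a set is red bare connectivity inside `Z` of the extension. -/
theorem zone_mem_reach_red_iff {S' : Set V} (v : V) :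
    v ∈ reach ((G.zoneFZ a b O Z).RedAdj (G.toStZ a b Z x)) S' ↔
      ∃ s ∈ S', Relation.ReflTransGen (G.RedIn a b (G.extZone a b O Z x) Z) s v := by
  constructor
  · rintro ⟨s, hs, h⟩
    refine ⟨s, hs, ?_⟩
    induction h with
    | refl => exact Relation.ReflTransGen.refl
    | tail _ hxy ih => exact ih.tail ((zone_redAdj_iff O x).1 hxy)
  · rintro ⟨s, hs, h⟩
    refine ⟨s, hs, ?_⟩
    induction h with
    | refl => exact Relation.ReflTransGen.refl
    | tail _ hxy ih => exact ih.tail ((zone_redAdj_iff O x).2 hxy)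

/-- The deleted vertices are the vertices of `Z` whose sub-zone is attached to `a`. -/
theorem zone_mem_D_iff (hsub : G.BlueSub a b O (G.extZone a b O Z x)) {v : V} (hv : v ∈ Z) :
    v ∈ (G.zoneFZ a b O Z).D (G.toStZ a b Z x) ↔ G.Attached a b (G.extZone a b O Z x) v a := by
  unfold ZoneData.D
  rw [zone_mem_reach_blue_iff O hZ x hsub (fun s hs => ((zone_mem_Bl_iff hc O hZ x s).1 hs).1)]
  constructor
  · rintro ⟨w, hw, hwv⟩
    obtain ⟨_, e, hj, hSe⟩ := (zone_mem_Bl_iff hc O hZ x w).1 hw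
    exact ⟨w, hwv.symm, e, hSe, hj⟩
  · rintro ⟨w, hvw, e, hSe, hj⟩
    exact ⟨w, (zone_mem_Bl_iff hc O hZ x w).2 ⟨mem_of_blueBareConn_idx O hZ hsub hv hvw, e, hj, hSe⟩,
      hvw.symm⟩

/-- The blue reach of the `2`-blockers: the vertices of `Z` whose sub-zone is attached to `b`. -/
theorem zone_mem_reach_M_iff (hsub : G.BlueSub a b O (G.extZone a b O Z x)) {v : V} (hv : v ∈ Z) :
    v ∈ reach ((G.zoneFZ a b O Z).BlueAdj (G.toStZ a b Z x)) ((G.zoneFZ a b O Z).M (G.toStZ a b Z x)) ↔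
      G.Attached a b (G.extZone a b O Z x) v b := by
  rw [zone_mem_reach_blue_iff O hZ x hsub (fun s hs => ((zone_mem_M_iff hc O hZ x s).1 hs).1)]
  constructor
  · rintro ⟨w, hw, hwv⟩
    obtain ⟨_, e, hj, hSe⟩ := (zone_mem_M_iff hc O hZ x w).1 hw
    exact ⟨w, hwv.symm, e, hSe, hj⟩
  · rintro ⟨w, hvw, e, hSe, hj⟩
    exact ⟨w, (zone_mem_M_iff hc O hZ x w).2 ⟨mem_of_blueBareConn_idx O hZ hsub hv hvw, e, hj, hSe⟩,
      hvw.symm⟩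

/-- Admissibility: no sub-zone of `Z` is attached to both terminals. -/
theorem zone_adm_iff (hsub : G.BlueSub a b O (G.extZone a b O Z x)) :
    (G.zoneFZ a b O Z).adm (G.toStZ a b Z x) ↔
      ∀ v ∈ Z, ¬ (G.Attached a b (G.extZone a b O Z x) v a ∧ G.Attached a b (G.extZone a b O Z x) v b) := by
  unfold ZoneData.adm
  constructor
  · intro h v hv ⟨ha, hb⟩
    obtain ⟨w, hvw, e, hSe, hj⟩ := hb
    have hw : w ∈ Z := mem_of_blueBareConn_idx O hZ hsub hv hvw
    have hwM : w ∈ (G.zoneFZ a b O Z).M (G.toStZ a b Z x) := (zone_mem_M_iff hc O hZ x w).2 ⟨hw, e, hj, hSe⟩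
    have hwD : w ∈ (G.zoneFZ a b O Z).D (G.toStZ a b Z x) := by
      rw [zone_mem_D_iff hc O hZ x hsub hw]
      exact attached_of_blueBareConn hvw.symm ha
    exact Set.disjoint_left.1 h hwM hwD
  · intro h
    rw [Set.disjoint_left]
    intro w hwM hwD
    obtain ⟨hw, e, hj, hSe⟩ := (zone_mem_M_iff hc O hZ x w).1 hwM
    rw [zone_mem_D_iff hc O hZ x hsub hw] at hwD
    exact h w hw ⟨hwD, w, BlueBareConn.refl a b _ w, e, hSe, hj⟩

/-- `Γ` for the protected anchor `{c} ∩ Z`: when `c ∈ Z` its sub-zone is attached to neither terminal. -/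
theorem zone_gam_iff (hsub : G.BlueSub a b O (G.extZone a b O Z x)) :
    (G.zoneFZ a b O Z).Gam (zoneQ c Z) (G.toStZ a b Z x) ↔
      (c ∈ Z → ¬ G.Attached a b (G.extZone a b O Z x) c a ∧ ¬ G.Attached a b (G.extZone a b O Z x) c b) := by
  unfold ZoneData.Gam ZoneData.P
  have hreach := zone_mem_reach_blue_iff O hZ x hsub (S' := zoneQ c Z) (fun s hs => hs.1 ▸ hs.2)
  constructor
  · intro h hcZ
    constructor
    · rintro ⟨w, hcw, e, hSe, hj⟩
      have hw : w ∈ Z := mem_of_blueBareConn_idx O hZ hsub hcZ hcw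
      exact Set.disjoint_left.1 h ((hreach w).2 ⟨c, ⟨rfl, hcZ⟩, hcw⟩)
        (Or.inl ((zone_mem_Bl_iff hc O hZ x w).2 ⟨hw, e, hj, hSe⟩))
    · rintro ⟨w, hcw, e, hSe, hj⟩
      have hw : w ∈ Z := mem_of_blueBareConn_idx O hZ hsub hcZ hcw
      exact Set.disjoint_left.1 h ((hreach w).2 ⟨c, ⟨rfl, hcZ⟩, hcw⟩)
        (Or.inr ((zone_mem_M_iff hc O hZ x w).2 ⟨hw, e, hj, hSe⟩))
  · intro h
    rw [Set.disjoint_left]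
    intro w hw hw'
    obtain ⟨s, ⟨hs, hcZ⟩, hsw⟩ := (hreach w).1 hw
    subst hs
    rcases hw' with hw' | hw'
    · obtain ⟨_, e, hj, hSe⟩ := (zone_mem_Bl_iff hc O hZ x w).1 hw'
      exact (h hcZ).1 ⟨w, hsw, e, hSe, hj⟩
    · obtain ⟨_, e, hj, hSe⟩ := (zone_mem_M_iff hc O hZ x w).1 hw'
      exact (h hcZ).2 ⟨w, hsw, e, hSe, hj⟩

omit [Fintype V] hc hZ in
/-- The forced colours: the red `O`-chords inside `Z` are red. -/
theorem zone_forced_iff :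
    (G.zoneFZ a b O Z).Forced (G.toStZ a b Z x) ↔
      ∀ e (h : G.ZoneEdge a b Z e), G.Bare a b e → O e = true → x ⟨e, h⟩ = true := by
  unfold FZone.Forced
  constructor
  · intro h e hZe he hO
    have := h ⟨e, zBare_of_zoneEdge hZe (not_zT1_of_bare he) (not_zT2_of_bare he)⟩ (by
      change ¬ (O e = false)
      rw [hO]
      decide)
    change x ⟨e, _⟩ = O e at this
    rw [this, hO]
  · intro h e hfree
    change x ⟨e.1, _⟩ = O e.1
    have hO : O e.1 = true := by
      cases h' : O e.1
      · exact absurd h' hfree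
      · rfl
    rw [hO]
    exact h e.1 _ e.2.1 hO

/-- **A zone-state is admissible iff its abstract state is forced, admissible and satisfies `Γ`** — the cube
condition on the opened edges is automatic in an indexed zone. -/
theorem zone_admZone_iff :
    G.AdmZone a b c O Z x ↔
      (G.zoneFZ a b O Z).Forced (G.toStZ a b Z x) ∧ (G.zoneFZ a b O Z).adm (G.toStZ a b Z x) ∧
        (G.zoneFZ a b O Z).Gam (zoneQ c Z) (G.toStZ a b Z x) := by
  unfold AdmZone
  constructor
  · rintro ⟨h1, _, h3, h4⟩
    have hsub := blueSub_extZone_of_chords h1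
    exact ⟨(zone_forced_iff O x).2 h1, (zone_adm_iff hc O hZ x hsub).2 h3, (zone_gam_iff hc O hZ x hsub).2 h4⟩
  · rintro ⟨hF, hA, hG⟩
    have h1 := (zone_forced_iff O x).1 hF
    have hsub := blueSub_extZone_of_chords h1
    refine ⟨h1, fun e hZe he hO _ => ?_, (zone_adm_iff hc O hZ x hsub).1 hA, (zone_gam_iff hc O hZ x hsub).1 hG⟩
    exact interiorBlue_of_idxZone hZ (zBare_of_zoneEdge hZe (not_zT1_of_bare he) (not_zT2_of_bare he)) hO

end Zone

end MultiGraph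

end PercRepro
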